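import Literature.Computability.Complexity.DownwardSelfReducibleEXP
import Literature.Computability.Complexity.TVDsrMachine
import HarnessLib

/-!
# Trevisan–Vadhan's `PSPACE`-complete language `LTV` is in `EXP`

Literature / complexity — derandomization under a uniform assumption (IW98 Case 2 in TV07 form).
Trevisan–Vadhan's language `LTV` (`TVFunction.lean`; `PSPACE`-hard: `TVHard.isHard_PSPACE_LTV`) is
downward self-reducible by the polynomial-time oracle machine `TVChk.dsrAlg` (`TVDsrMachine.lean`,
`TVChk.dsrAlg_run`), hence decidable in exponential time (`DsrExp.mem_EXP_of_dsr_language`,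
`DownwardSelfReducibleEXP.lean`: tabulation over the shorter words). This is the time bound under
which its truth tables feed the Impagliazzo–Wigderson generator (TV07, proof of Thm. 3.9 with Thm. 4.3:
"F ∈ PSPACE ⊆ EXP").

* **`QBFUniv.LTV_mem_EXP : LTV ∈ EXP`.**

Everything is proved; no definitions, no named facts.

## References

* [TrevisanVadhan2007] L. Trevisan, S. Vadhan, Comput. Complexity 16 (2007), Thm. 4.3 (`F` is
  `PSPACE`-complete, in particular in `PSPACE ⊆ EXP`) and §3 (before Lemma 3.7: downward
  self-reducible problems lie in `PSPACE`).
* [AroraBarakCC2009] S. Arora, B. Barak, CUP 2009, Thm. 2.22 (proof: padding), §4.2 (`PSPACE ⊆ EXP`).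
-/

namespace Literature.Computability.Complexity

open _root_.Computability Polynomial

/-- **`LTV ∈ EXP`** (from its downward self-reduction `TVChk.dsrAlg_run`).
[cite: TrevisanVadhan2007, Thm. 4.3 and §3 (before Lemma 3.7)] -/
theorem QBFUniv.LTV_mem_EXP : QBFUniv.LTV ∈ EXP :=
  DsrExp.mem_EXP_of_dsr_language TVChk.dsrAlg_isPolyTime TVChk.dsrAlg_run

end Literature.Computability.Complexity
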